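import Summits.AtomisticToContinuum.HydrodynamicLimit.Theorems.MourreKoopmanChargesLinearToEntropyInBandBallContentDefs
import Summits.AtomisticToContinuum.HydrodynamicLimit.Theorems.MourreKoopmanChargesLinearToEntropyInBandSpliceCore
import HarnessLib

/-!
# TYPING SCRATCH (not for landing): `MacroscopicCollarInfluenceLocality` (MCIL) — item 4e of the sizing memo
# `VOBE-DECOMPOSITION` § 4 of stub 4a-i `stub_visibleOneBlockEstimateInBand` (crux stmt-AtomisticToContinuum-17740),
# with the two entropy transfers (4t) as `sorry`d signatures.  For the planner filing child (B)
# `MacroscopicCollarLocality` of the promoted stub, and for a refuter pass on the exact typing.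

`sorry` only in the two transfer signatures at the end.  Everything is in the tree's vocabulary
(`HardSphereFlow`, `FlowFamily`, `gibbsLaw`, `localGibbsLaw`, `hsDiameter`, `Torus.euclidDist`, `Torus.proj`) plus
THREE constructs typed here (a planner would move them to an objects part E):

* `isolatedFlow Bp Φ Ψ s` — the ISOLATED dynamics of the content of the region `Bp ⊆ 𝕋³` from time `s` on (the wave-3
  typing of `VOBEPlan.isolatedFlow`, index generalised from `N + 1` to `N`): up to time `s` it is `Φ`; after `s` the
  particles whose position AT TIME `s` lies in `Bp` evolve under the hard-sphere flow `Ψ n` of their own number `n`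
  (same diameter, same torus), ignoring everybody else, and the others fly freely.
* `badSet B Bp Φ Ψ s w z` / `badCount` — the particles whose window trajectory is NOT `Bp`-local AND which matter
  for a functional supported in `B`: the POSITION paths of `i` under the full flow and under the isolated-`Bp` flow
  differ at some time of the window `[s, s + w]` (positions, not phase points: continuous in time, so immune to the
  velocity convention at collision instants), and `i` visits `B` during the window under one of the two dynamics.
  The second clause is the COLLAR: with `B = ball(c, r₁) ⊂ Bp = ball(c, r₂)` a corruption seeded at `∂Bp` must
  cross the macroscopic collar `r₂ - r₁` within the microscopic window `w = τ (M+1)^{-1/3}` to be counted; without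
  it (all corrupted particles of `Bp`) the statement is the LAYER2-blocked microscopic one and presumably FALSE at
  fixed amplitude (memo § 4, § 6).
* `MacroscopicCollarInfluenceLocality` — **MCIL**: in the dilute band, under the flow-invariant homogeneous
  canonical hard-sphere law `G_M = gibbsLaw θ u ε Φ M` of the `(M+1)`-sphere torus system with `(M+1) ε_M³ → σ'³`,
  for EVERY amplitude `a > 0`, every window length `τ > 0` and every pair of radii `0 < r₁ < r₂ < 1/4`,
  `limsup_M (M+1)⁻¹ log E_{G_M} exp(a · #bad(ball(c,r₁), ball(c,r₂), window [0, τ(M+1)^{-1/3}])) ≤ 0`.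

Quantifier order (refuter-grade): `∃ σ₀ > 0` (the dilute band, FIRST and alone) `∀ σ' ∈ (0, σ₀) ∀ θ > 0 ∀ u ∀ ε`
(`ε_M > 0`, `(M+1) ε_M³ → σ'³`) `∀ Φ : FlowFamily ε ∀ Ψ` (isolated flows of every particle number, same diameter)
`∀ a > 0 ∀ τ > 0 ∀ r₁ r₂ (0 < r₁ < r₂ < 1/4) ∀ c : 𝕋³`, `limsup_M … ≤ 0` — the limsup POINTWISE in everything
(the consumer fixes a finite `r`-grid of centres, `τ`, and chooses the amplitude `a = a(δ, r, K)` before `M → ∞`;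
start time `0` suffices under the INVARIANT law `G_M`, stationarity moving the window).  No uniformity in `c` is
claimed (none is needed for a finite grid; translation covariance of `Φ` is not a field of `HardSphereFlow`).

Heuristics for TRUE (memo § 4): `w` is `π σ'² τ` mean free times; crossing the collar in time `w` costs kinetic
energy `≥ c (r₂ - r₁)² (M+1)^{2/3} / τ²` along the carrier chain (Cauchy–Schwarz) or `≥ m₀/2`,
`m₀ = (r₂ - r₁)(M+1)^{1/3}/(20 σ')`, slow links, hence a long STATIC `4ε`-chain at one of `J = Vτ/σ'` times
(pigeonhole); static LD of the dilute hard-core Gibbs law (subcritical `4ε`-proximity graph, the guard `σ' < σ₀`)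
and chi-square tails make both super-exponentially rare, while the payoff per seed is `≤ a · n_max(τ)`; free
flights across the collar need speed `≥ (r₂ - r₁)(M+1)^{1/3}/τ`, Maxwellian cost `e^{-c M^{2/3}}` per particle,
and velocities are i.i.d. Maxwellian under `G_M`.  So the rate is `o(M)` at every fixed `a` (indeed with room
`a_c(M) → ∞`).  Proof route 4k + 4s + 4e of the memo; NOT in the tree (nearest: `HardSphereAlexander` — cluster
dynamics / finite speed of influence for SHORT times, Alexander 1975, CIP 1994 Thm 4.2.1; `HardSphereCollisionRecord`;
`uniformLocalGibbsConcentration_proof`; Poisson domination tools `PoissonMecke*`).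

Documented junk: `Φ.flow` / `(Ψ n).flow` off their Liouville-conull good sets (the `Bp`-content at time `s` of a
`G_M`-distributed configuration has, for each of the finitely many index sets, a law absolutely continuous w.r.t.
Liouville on the sub-system, so the junk is invisible under `G_M`, under the true law and under the splice law of
an a.c. `f`); `badCount` is not manifestly measurable (an `∃ t` over the window) — on the good sets positions
are continuous in `t`, so the `∃ t` may be restricted to rational times and `badCount` is a.e.-measurable under
every a.c. law; this lemma is part of 4k and a refuter should insist on it, because Mathlib's `∫⁻` of a
NON-measurable function is the LOWER integral (which would weaken MCIL silently);
`ENNReal.log 0 = ⊥` makes MCIL vacuous where `gibbsLaw` degenerates (jammed `(M+1)ε³`, excluded eventually in the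
dilute band); `r₂ < 1/4` keeps `ball(c, r₂)` a metric ball of the unit torus not wrapping around.

The two TRANSFERS (4t), typed as `sorry`d signatures below (both are the entropy inequality
`E_μ X ≤ a⁻¹ (KL(μ ‖ G) + log E_G e^{aX})` plus bookkeeping; S–M each GIVEN MCIL and, for the first, the static fact
`KL(localGibbsLaw σ a₀ u₀ θ₀ N ‖ localGibbsLaw σ 1 ū θ̄ N) ≤ C_G (N+1)` with flow invariance of the homogeneous law,
`measurePreserving_flow_localGibbsLaw`):
* `expected_badCount_true_le` — under the TRUE law of the `N`-system at every window start `s ∈ [0, T]`: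
  `E_P #bad_s ≤ δ (N+1)` eventually, `∀ δ τ r₁ r₂ c`;
* `expected_badCount_splice_le` — under the SPLICE law `spliceLaw Bp f G_M` of ANY probability `f` (on any
  `n`-system) with `f|_{Bp} ≪ G_M|_{Bp}`: `E #bad_0 ≤ KL(f|_{Bp} ‖ G_M|_{Bp}) / a + δ (M+1)` eventually, `∀ a δ …`
  (in `ℝ≥0∞`, so `KL = ⊤` is harmless; `klDiv_spliceLaw`, `spliceLaw_absolutelyContinuous` of `…BallContent`).
What 4t does NOT yet contain: the per-particle bound of the DIFFERENCE of the window functionals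
`visCoreN(full) − visCoreOfFlow(isolated)` by `C(K) · w · Σ_{bad i} (1 + #collisions of i in the window)` — the
collision multiplicity of bad VISIBLE particles needs either a collision-weighted MCIL (replace `#bad` by
`Σ_{bad} (1 + #coll)`; presumably still true by the distinct-partner counting of memo 4s) or a separate static bound;
flagged for the planner.
-/

noncomputable section

open MeasureTheory Filter Set
open scoped ENNReal Topology

namespace Summit.AtomisticToContinuum.HydrodynamicLimit.Theorems.LTEInBand.MCIL

open Literature.MathematicalPhysics.KineticTheory Literature.Analysis.FluidPDE Literature.Analysis.FunctionSpaces
open Summit.AtomisticToContinuum.HydrodynamicLimit.Theorems.LTEInBand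

/-! ## The isolated dynamics of the content of a region -/

/-- **Isolated dynamics of the `Bp`-content from time `s` on.**  For `t ≤ s` it is the full flow `Φ`.  For `t > s`:
let `y = Φ_s z`, `I = {i | (y i).1 ∈ Bp}` (increasing enumeration `e : Fin |I| ≃o I`), `sub = y ∘ e` the labelled
sub-configuration; the particles of `I` sit at `((Ψ |I|).flow (t - s) sub) (e⁻¹ i)` — the hard-sphere flow of
their own number, same diameter `ε`, same torus, nobody else present — and the particles outside `I` fly freely,
`(x + (t - s) v, v)`.  Junk: `Φ.flow`/`(Ψ n).flow` off their good sets. -/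
def isolatedFlow (Bp : Set T3) {ε : ℝ} {N : ℕ} (Φ : HardSphereFlow (Torus.geometry (Fin 3)) ε N)
    (Ψ : (n : ℕ) → HardSphereFlow (Torus.geometry (Fin 3)) ε n) (s : ℝ) :
    ℝ → Config N (Fin 3) T3 → Config N (Fin 3) T3 := fun t z => by
  classical
  exact
    if t ≤ s then Φ.flow t z
    else
      let y := Φ.flow s z
      let I : Finset (Fin N) := Finset.univ.filter fun i => (y i).1 ∈ Bp
      let e := I.orderIsoOfFin rfl
      let sub : Config I.card (Fin 3) T3 := fun j => y (e j)
      let ev := (Ψ I.card).flow (t - s) sub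
      fun i => if h : i ∈ I then ev (e.symm ⟨i, h⟩) else ((y i).1 + Torus.proj ((t - s) • (y i).2), (y i).2)

/-! ## Bad particles: non-local window trajectories that matter inside `B` -/

/-- **The bad set** of the window `[s, s + w]` for the pair `B ⊆ Bp`: particles `i` whose POSITION path under the
full flow `Φ` and under the isolated-`Bp` flow differ at some time of the window, and which visit `B` during the
window under at least one of the two dynamics. -/
def badSet (B Bp : Set T3) {ε : ℝ} {N : ℕ} (Φ : HardSphereFlow (Torus.geometry (Fin 3)) ε N)
    (Ψ : (n : ℕ) → HardSphereFlow (Torus.geometry (Fin 3)) ε n) (s w : ℝ) (z : Config N (Fin 3) T3) :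
    Set (Fin N) :=
  {i | (∃ t ∈ Set.Icc s (s + w), (Φ.flow t z i).1 ≠ (isolatedFlow Bp Φ Ψ s t z i).1) ∧
    ∃ t ∈ Set.Icc s (s + w), (Φ.flow t z i).1 ∈ B ∨ (isolatedFlow Bp Φ Ψ s t z i).1 ∈ B}

/-- **`#bad`**: the number of bad particles of the window (a natural number `≤ N`). -/
def badCount (B Bp : Set T3) {ε : ℝ} {N : ℕ} (Φ : HardSphereFlow (Torus.geometry (Fin 3)) ε N)
    (Ψ : (n : ℕ) → HardSphereFlow (Torus.geometry (Fin 3)) ε n) (s w : ℝ) (z : Config N (Fin 3) T3) : ℕ :=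
  (badSet B Bp Φ Ψ s w z).ncard

/-! ## MCIL -/

/-- **Macroscopic-collar influence locality (MCIL)** under the invariant homogeneous canonical hard-sphere law, at
EVERY fixed amplitude: `∃ σ₀ > 0 ∀ σ' ∈ (0, σ₀) ∀ θ > 0 ∀ u ∀ ε (ε_M > 0, (M+1) ε_M³ → σ'³) ∀ Φ ∀ Ψ ∀ a > 0 ∀ τ > 0
∀ 0 < r₁ < r₂ < 1/4 ∀ c`,
`limsup_M (M+1)⁻¹ log ∫ exp(a · #bad(ball(c, r₁), ball(c, r₂), Φ M, Ψ M, window [0, τ (M+1)^{-1/3}])) dG_M ≤ 0`,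
`G_M = gibbsLaw θ u ε Φ M`.  The number of particles whose window trajectory feels the outside of a CONCENTRIC
MACROSCOPIC ball and which enter the inner ball has sub-exponential exponential moments at every amplitude.  OPEN
(item 4e of the memo; crux material of child (B)); never asserted. -/
def MacroscopicCollarInfluenceLocality : Prop :=
  ∃ σ₀ : ℝ, 0 < σ₀ ∧ ∀ σ' : ℝ, 0 < σ' → σ' < σ₀ → ∀ θ : ℝ, 0 < θ → ∀ u : V3,
    ∀ ε : ℕ → ℝ, (∀ M, 0 < ε M) → Tendsto (fun M : ℕ => ((M : ℝ) + 1) * ε M ^ 3) atTop (𝓝 (σ' ^ 3)) →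
    ∀ (Φ : FlowFamily ε) (Ψ : (M n : ℕ) → HardSphereFlow (Torus.geometry (Fin 3)) (ε M) n),
    ∀ a : ℝ, 0 < a → ∀ τ : ℝ, 0 < τ → ∀ r₁ r₂ : ℝ, 0 < r₁ → r₁ < r₂ → r₂ < 1 / 4 → ∀ c : T3,
      limsup (fun M : ℕ => ((((M : ℝ) + 1)⁻¹ : ℝ) : EReal) *
        ENNReal.log (∫⁻ z, ENNReal.ofReal (Real.exp (a *
          (badCount {x | Torus.euclidDist c x < r₁} {x | Torus.euclidDist c x < r₂} (Φ M) (Ψ M) 0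
            (τ * ((M : ℝ) + 1) ^ (-(1 / 3 : ℝ))) z : ℝ))) ∂(gibbsLaw θ u ε Φ M))) atTop ≤ 0

/-! ## The two transfers (4t), signatures only -/

/-- **(4t, true law)** From MCIL and the `O(N)` relative entropy of the local Gibbs law w.r.t. the INVARIANT
homogeneous law `G_N = localGibbsLaw σ 1 ū θ̄ N (Φ N)` (conserved along the flow): the expected number of bad
particles of a window starting at ANY time `s ∈ [0, T]` under the TRUE law of the `N`-system is `≤ δ (N+1)`
eventually — entropy inequality at amplitude `a = 2 C_G / δ`, then MCIL with `M := N`, `ε_N = hsDiameter σ N`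
(`(N+1) ε_N³ = σ³`).  `sorry`: to be proved in child (B)/(C). -/
theorem expected_badCount_true_le (hMCIL : MacroscopicCollarInfluenceLocality) :
    ∀ (a₀ θ₀ : T3 → ℝ) (u₀ : T3 → V3), Continuous a₀ → Continuous θ₀ → Continuous u₀ →
      (∀ x, 0 < a₀ x) → (∀ x, 0 < θ₀ x) →
      ∃ σ₀ : ℝ, 0 < σ₀ ∧ ∀ σ : ℝ, 0 < σ → σ < σ₀ →
        ∀ (Φ : (N : ℕ) → HardSphereFlow (Torus.geometry (Fin 3)) (hsDiameter σ N) (N + 1))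
          (Ψ : (N n : ℕ) → HardSphereFlow (Torus.geometry (Fin 3)) (hsDiameter σ N) n) (T : ℝ),
        ∀ δ : ℝ, 0 < δ → ∀ τ : ℝ, 0 < τ → ∀ r₁ r₂ : ℝ, 0 < r₁ → r₁ < r₂ → r₂ < 1 / 4 → ∀ c : T3,
        ∃ N₀ : ℕ, ∀ N : ℕ, N₀ ≤ N → ∀ s ∈ Set.Icc 0 T,
          ∫⁻ z, (badCount {x | Torus.euclidDist c x < r₁} {x | Torus.euclidDist c x < r₂} (Φ N) (Ψ N) s
              (τ * ((N : ℝ) + 1) ^ (-(1 / 3 : ℝ))) z : ℝ≥0∞) ∂(localGibbsLaw σ a₀ u₀ θ₀ N (Φ N)) ≤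
            ENNReal.ofReal (δ * ((N : ℝ) + 1)) := by
  sorry

/-- **(4t, splice law)** From MCIL: under the splice law `spliceLaw Bp f G_M` (`Bp = ball(c, r₂)`,
`G_M = gibbsLaw θ u ε Φ M`) of ANY probability `f` on any `n`-system with `f|_{Bp} ≪ G_M|_{Bp}`, the expected number
of bad particles of the window at time `0` is `≤ KL(f|_{Bp} ‖ G_M|_{Bp}) / a + δ (M+1)` eventually in `M`,
uniformly in `f` — entropy inequality against `G_M` (`spliceLaw_absolutelyContinuous`, `klDiv_spliceLaw`) and
MCIL at amplitude `a`.  In `ℝ≥0∞` (`KL = ⊤` harmless).  `sorry`: to be proved in child (B)/(C). -/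
theorem expected_badCount_splice_le (hMCIL : MacroscopicCollarInfluenceLocality) :
    ∃ σ₀ : ℝ, 0 < σ₀ ∧ ∀ σ' : ℝ, 0 < σ' → σ' < σ₀ → ∀ θ : ℝ, 0 < θ → ∀ u : V3,
      ∀ ε : ℕ → ℝ, (∀ M, 0 < ε M) → Tendsto (fun M : ℕ => ((M : ℝ) + 1) * ε M ^ 3) atTop (𝓝 (σ' ^ 3)) →
      ∀ (Φ : FlowFamily ε) (Ψ : (M n : ℕ) → HardSphereFlow (Torus.geometry (Fin 3)) (ε M) n),
      ∀ a : ℝ, 0 < a → ∀ δ : ℝ, 0 < δ → ∀ τ : ℝ, 0 < τ → ∀ r₁ r₂ : ℝ, 0 < r₁ → r₁ < r₂ → r₂ < 1 / 4 →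
      ∀ c : T3, ∃ M₀ : ℕ, ∀ M : ℕ, M₀ ≤ M →
        ∀ (n : ℕ) (f : Measure (Config n (Fin 3) T3)), IsProbabilityMeasure f →
          ballMarginal {x | Torus.euclidDist c x < r₂} f ≪
            ballMarginal {x | Torus.euclidDist c x < r₂} (gibbsLaw θ u ε Φ M) →
          ∫⁻ z, (badCount {x | Torus.euclidDist c x < r₁} {x | Torus.euclidDist c x < r₂} (Φ M) (Ψ M) 0
              (τ * ((M : ℝ) + 1) ^ (-(1 / 3 : ℝ))) z : ℝ≥0∞)
              ∂(spliceLaw {x | Torus.euclidDist c x < r₂} f (gibbsLaw θ u ε Φ M)) ≤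
            InformationTheory.klDiv (ballMarginal {x | Torus.euclidDist c x < r₂} f)
                (ballMarginal {x | Torus.euclidDist c x < r₂} (gibbsLaw θ u ε Φ M)) / ENNReal.ofReal a +
              ENNReal.ofReal (δ * ((M : ℝ) + 1)) := by
  sorry

end Summit.AtomisticToContinuum.HydrodynamicLimit.Theorems.LTEInBand.MCIL

end
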